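import Summits.CriticalPhenomena.PercolationContinuityZ3.Theorems.PercNearOneGluingNoHeavyQuantFarTreeHubBlocksFar
import Summits.CriticalPhenomena.PercolationContinuityZ3.Theorems.PercNearOneGluingNoHeavyQuantGateVertexReduction
import HarnessLib

/-!
# QUANT lane R8, FAR on trees: "hub with leaves + root blocks of ARBITRARY gates `≥ g₀ ≥ 1/2`" from the common-gate theorem by
# gate monotonicity (lead g11's all-floors reduction)

builds on p205010 (kernel theorem, internal audit signed; external expert review pending)

Support file (`--supports stmt-CriticalPhenomena-4575`), QUANT lane typer seat prim-quant-stmt (gen 14), rung R8 of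
`run/shared/lean/prim/quant/LADDER.md`; typer target of the gen-11 lead (lane INBOX 2026-08-20T23:25Z (1): "with p239995 every common-gate FAR
theorem extends to arbitrary gates inside its all-floors class … first instance: `farTree_hubBlocks_commonGate`").  Theorems only; no definitions,
no sorries, standard axioms.

The light event `{#reached ≤ j}` is a LOWER set of the gate configuration, so its probability can only go DOWN when a gate is raised
(`Quant.prodBernoulli_real_le_of_floors`, `…QuantGateVertexReduction.lean`, lead g11 N22 (1c)): a bound proved with every block gate AT THE FLOOR
`g₀` holds for every gate vector with block gates `≥ g₀`, provided the hypotheses are read at the floor (mean counted at `g₀`, cut `1 − g₀ ≤ t`).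

* `Quant.isLowerSet_light_parDepth` — the light event of the `par`/`depth` hub vocabulary is a lower set.
* `Quant.farTree_hubBlocks_blockGates` — **FAR at every layer for "hub `h` with leaves `L` (arbitrary gates) + any number of root blocks `b ∈ K`
  with gates `q b ≥ g₀ ≥ 1/2` and sure tails `B b`"**: if `2j < q h·Σ_{L} q + g₀·Σ_{K} (|B b| + 1)` (the mean COUNTED AT THE FLOOR), `1 − g₀ ≤ t`
  and `1 − q h·q ℓ₀ ≤ t`, then `P(#{a counted} ≤ j) ≤ t` — stmt g11's `Quant.farTree_hubBlocks_commonGate` (V116) at the all-floors corner +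
  monotonicity.  (When the least likely relay is a block, `g₀ = min_K q` and `t ≥ 1 − g₀` is the route's own cut hypothesis; the floor-counted
  mean is the honest price of the reduction.)
[this work]; [cite: KozmaNitzan2024, Conjecture 3 (p. 15)] (the gluing rows `Quant.FarTreeRow` serves).
-/

noncomputable section

namespace Summit.CriticalPhenomena.PercolationContinuityZ3.Theorems

namespace Quant

open Finset MeasureTheory
open Literature.Probability.LatticeModels
open Literature.Probability.Percolation
open scoped Classical

variable {n : ℕ}

/-- The light event "at most `j` of the relays of `S` have their whole root path open" (hub vocabulary: `a = o ∨ ∀ i ≤ depth a, par^[i] a ∈ ω`)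
is a LOWER set: closing gates only removes reached relays. [folklore] -/
theorem isLowerSet_light_parDepth (S : Finset (Fin n)) (o : Fin n) (depth : Fin n → ℕ) (par : Fin n → Fin n) (j : ℕ) :
    IsLowerSet {ω' : Set (Fin n) | (S.filter fun a => a = o ∨ ∀ i, i ≤ depth a → par^[i] a ∈ ω').card ≤ j} := by
  intro ω₁ ω₂ hle hω₁
  have h1 : (S.filter fun a => a = o ∨ ∀ i, i ≤ depth a → par^[i] a ∈ ω₁).card ≤ j := hω₁
  refine le_trans (Finset.card_le_card fun a ha => ?_) h1
  rw [Finset.mem_filter] at ha ⊢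
  refine ⟨ha.1, ?_⟩
  rcases ha.2 with h | h
  · exact Or.inl h
  · exact Or.inr fun i hi => hle (h i hi)

/-- **FAR at every layer for "hub with leaves + root blocks of ARBITRARY gates `≥ g₀ ≥ 1/2`".**  Setting of `Quant.farTree_hubBlocks_commonGate`
(observer `o`; hub `h` with leaf relays `L`, `ℓ₀ ∈ L` least reliable; block vertices `b ∈ K` at the root with sure tails `B b`), except that the
block gates are only required to satisfy `g₀ ≤ q b` for a common floor `g₀ ≥ 1/2`; the mean hypothesis is counted at the floor,
`2j < q h·Σ_{a∈L} q a + g₀·Σ_{b∈K} (|B b| + 1)`, and the cuts are `1 − g₀ ≤ t`, `1 − q h·q ℓ₀ ≤ t`.  Then `P(#{a ∈ A counted} ≤ j) ≤ t`.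
Proof: lower the block gates to `g₀` (`Quant.prodBernoulli_real_le_of_floors`; the light event is a lower set) and apply the common-gate theorem.
[this work] -/
theorem farTree_hubBlocks_blockGates (q : Fin n → unitInterval) (o h ℓ₀ : Fin n) (L K : Finset (Fin n))
    (B : Fin n → Finset (Fin n)) (depth : Fin n → ℕ) (par : Fin n → Fin n) (j : ℕ) (t : ℝ) (g₀ : unitInterval)
    (hK : ∀ b ∈ K, par b = o ∧ depth b = 0)
    (hL : ∀ a ∈ L, par a = h ∧ depth a = 1) (hB : ∀ b ∈ K, ∀ a ∈ B b, par a = b ∧ depth a = 1)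
    (hhL : h ∉ L) (hhK : h ∉ K) (hLK : Disjoint L K) (hLB : ∀ b ∈ K, Disjoint L (B b))
    (hKB : ∀ b ∈ K, ∀ b' ∈ K, b ∉ B b') (hBB : ∀ b ∈ K, ∀ b' ∈ K, b ≠ b' → Disjoint (B b) (B b'))
    (hqB : ∀ b ∈ K, ∀ a ∈ B b, q a = 1) (hℓ₀ : ℓ₀ ∈ L) (hmin : ∀ a ∈ L, (q ℓ₀ : ℝ) ≤ q a)
    (hg : ∀ b ∈ K, g₀ ≤ q b) (hhalf : (1 / 2 : ℝ) ≤ (g₀ : ℝ))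
    (hEN : (2 * j : ℝ) < (q h : ℝ) * ∑ a ∈ L, (q a : ℝ) + ∑ b ∈ K, (g₀ : ℝ) * (((B b).card : ℝ) + 1))
    (htK : 1 - (g₀ : ℝ) ≤ t) (htℓ : 1 - (q h : ℝ) * q ℓ₀ ≤ t) :
    (prodBernoulli q).real {ω' : Set (Fin n) |
      ((L ∪ K.biUnion fun b => insert b (B b)).filter
        fun a => a = o ∨ ∀ i, i ≤ depth a → par^[i] a ∈ ω').card ≤ j} ≤ t := by
  have hlow := isLowerSet_light_parDepth (L ∪ K.biUnion fun b => insert b (B b)) o depth par j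
  refine prodBernoulli_real_le_of_floors _ hlow K (fun _ => g₀) t q (fun b hb => hg b hb) ?_
  intro q' hoff hK'
  -- `q'` agrees with `q` at the hub, on the leaves and on the block tails, and equals `g₀` on the blocks
  have hq'h : q' h = q h := hoff h hhK
  have hq'L : ∀ a ∈ L, q' a = q a := fun a ha => hoff a fun haK => Finset.disjoint_left.1 hLK ha haK
  have hq'B : ∀ b ∈ K, ∀ a ∈ B b, q' a = q a := fun b hb a ha => hoff a fun haK => hKB a haK b hb ha
  refine farTree_hubBlocks_commonGate q' o h ℓ₀ L K B depth par j t (g₀ : ℝ) hK hL hB hhL hhK hLK hLB hKB hBB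
    (fun b hb a ha => by rw [hq'B b hb a ha]; exact hqB b hb a ha) hℓ₀
    (fun a ha => by rw [hq'L ℓ₀ hℓ₀, hq'L a ha]; exact hmin a ha)
    (fun b hb => by rw [hK' b hb]) hhalf ?_ (fun b hb => by rw [hK' b hb]; exact htK)
    (by rw [hq'h, hq'L ℓ₀ hℓ₀]; exact htℓ)
  have e1 : ∑ a ∈ L, ((q' a : unitInterval) : ℝ) = ∑ a ∈ L, ((q a : unitInterval) : ℝ) :=
    Finset.sum_congr rfl fun a ha => by rw [hq'L a ha]
  have e2 : ∑ b ∈ K, ((q' b : unitInterval) : ℝ) * (((B b).card : ℝ) + 1) = ∑ b ∈ K, ((g₀ : unitInterval) : ℝ) * (((B b).card : ℝ) + 1) :=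
    Finset.sum_congr rfl fun b hb => by rw [hK' b hb]
  rw [hq'h, e1, e2]
  exact hEN

end Quant

end Summit.CriticalPhenomena.PercolationContinuityZ3.Theorems

end
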